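import Summits.BirchSwinnertonDyer.BirchSwinnertonDyer.Theorems.BiquadraticEisensteinDescentHeegnerTwistCouplingInSupplyQuarticLocal
import Summits.BirchSwinnertonDyer.BirchSwinnertonDyer.Theorems.BiquadraticEisensteinDescentHeegnerTwistCouplingInSupplySqrtTwoCell
import Mathlib.NumberTheory.LegendreSymbol.QuadraticReciprocity
import HarnessLib

set_option linter.dupNamespace false -- `Summit.BirchSwinnertonDyer.BirchSwinnertonDyer.Theorems.…` (summit = sub)
set_option autoImplicit false

/-!
# Crux `HeegnerTwistCouplingInSupply` (stmt-BirchSwinnertonDyer-21381) — the QUARTIC cell, `φ̂`-side: for `X_B : y² = x³ + B x`,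
# `B = p^k q² l²` (`j = 1728`, Kodaira III/III* at `p`), `p ≡ 15 (mod 16)`, `k ∈ {1, 3}`, `q ≡ 3`, `l ≡ 5 (mod 8)`, `(l/p) = −1`:
# `S^{(φ̂)}(X_B) ⊆ {1, p}` — UNCONDITIONAL (no named fact)

Route `BiquadraticEisensteinDescent` (cell `pub/bsd-wall`, width seat `bsd-wall-cm-bed-w3` g12; `--supports` 21381, helper). Second of
four files on the QUARTIC members `X_A : y² = x³ + A x`, `A ∈ {p, p³}`, `p ≡ 3 (mod 4)` (additive of Kodaira type III / III* at `p`,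
`e = 4`, depth-zero supercuspidal; CM by `ℤ[i]` with `p` inert; root number `−1` exactly for `p ≡ 15 (mod 16)`, PARI kit j314587) of the
CM-inert-bad corner of crux 21381 — the half of the `j = 1728` corner not covered by the quadratic-twist files (`E_p`, `E_{2p}`,
`B_n`) of the lead `bsd-line-ibd-p1` g10/g11 and the width seats w4 g12, w1 g10, w2 g12. For a Heegner field `K′ = ℚ(√−ql)` of `N(X_A)`
the twist is `X_A^{(−ql)} = X_{A q² l²}`; this file and its sequel `…QuarticCell` run the complete `2`-isogeny descent of `X_{p^k q² l²}`
in THE CELL (= the `E_p` cell `{(3,+), (5,−)}` of `…CornersThreeFacts.exists_cellData_p`, transplanted): `p ≡ 15 (mod 16)`,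
`q ≡ 3 (mod 8)` with `(q/p) = +1`, `l ≡ 5 (mod 8)` with `(l/p) = −1`, `k ∈ {1, 3}`, in the tree's vocabulary (`twoIsogenySelmerGroup 0 B =
S^{(φ̂)}`: descent on the square-free divisors `d` of `B`, quartics `w² = d u⁴ + (B/d) z⁴`; Silverman AEC X.4.9).

* §1 arithmetic of square-free divisors (`eq_of_squarefree_dvd_four_mul_prime_pow` &c.), the symbols `(p/q) = (p/l) = −1` by
  reciprocity, and `not_isSoluble_of_dvd_of_sq_dvd`: **the reduced-discriminant kill** at a prime `r` with `r ∣ d`, `d ∣ b = c r²` and `−4c`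
  a non-residue (w1 g10's `…SqrtTwoCell.not_isSoluble_padic_of_dvd_of_not_isSquare_disc` with `a = 0`);
* §2 ★ `mem_twoIsogenySelmerGroup_phiHat` — **`S^{(φ̂)}(X_B) ⊆ {1, p}`**: negatives die over `ℝ`; `l ∣ d` dies `l`-adically (reduced
  discriminant `−4 p^k q²`, a non-residue as `(p/l) = −1`, `(−1/l) = +1`); the remaining `d ∈ {q, pq}` die `2`-adically
  (`…QuarticLocal.not_isSoluble_two_q/_pq` — where `p ≡ 15 (mod 16)` enters; `(q/p) = +1` is NOT used on this side);
  `eq_of_squarefree_dvd_phi` — the square-free divisors of `−4B` prime to `ql` are `±{1, 2, p, 2p}` (input of the `φ`-side in the sequel).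

PARI cross-check (kit j314832, evidence on 21381): 166/166 clean triples at `p ≡ 15 (mod 16)`. HONEST FRAMING: unconditional arithmetic of one
explicit CM family; nothing about `L`-values, the crux (all CM `W` of analytic rank one; residual C⁺) or BSD is proved here. THEOREMS ONLY;
supports stmt-BirchSwinnertonDyer-21381.
-/

noncomputable section

open scoped Classical

namespace Summit.BirchSwinnertonDyer.BirchSwinnertonDyer.Theorems.BiquadraticEisensteinDescentHeegnerTwistCouplingInSupplyQuarticCellPhiHat

open _root_.WeierstrassCurve Literature.NumberTheory.EllipticCurves
open Summit.BirchSwinnertonDyer.BirchSwinnertonDyer.Theorems.BiquadraticEisensteinDescentHeegnerTwistCouplingInSupplySqrtTwoCell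
  (not_isSoluble_padic_of_dvd_of_not_isSquare_disc)
open Summit.BirchSwinnertonDyer.BirchSwinnertonDyer.Theorems.BiquadraticEisensteinDescentHeegnerTwistCouplingInSupplyQuarticLocal

/-! ## §1 Arithmetic, symbols, and the reduced-discriminant kill -/

section Arith

/-- Square-free divisors of a prime power are `1` or the prime. [folklore] -/
theorem eq_one_or_eq_of_squarefree_dvd_prime_pow {n r m : ℕ} (hr : r.Prime) (hn : Squarefree n) (h : n ∣ r ^ m) :
    n = 1 ∨ n = r := by
  obtain ⟨i, -, rfl⟩ := (Nat.dvd_prime_pow hr).mp h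
  rcases i with _ | _ | i
  · exact Or.inl (pow_zero r)
  · exact Or.inr (pow_one r)
  · exfalso
    have := hn r ⟨r ^ i, by ring⟩
    rw [Nat.isUnit_iff] at this
    exact hr.one_lt.ne' this

/-- Square-free divisors of `4 r^m` (`r` a prime) are `1, 2, r, 2r`. [folklore] -/
theorem eq_of_squarefree_dvd_four_mul_prime_pow {n r m : ℕ} (hr : r.Prime) (hn : Squarefree n) (h : n ∣ 4 * r ^ m) :
    n = 1 ∨ n = 2 ∨ n = r ∨ n = 2 * r := by
  have four : ∀ c : ℕ, Squarefree c → c ∣ 4 → c = 1 ∨ c = 2 := fun c hc hc4 =>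
    eq_one_or_eq_of_squarefree_dvd_prime_pow (m := 2) Nat.prime_two hc (by simpa using hc4)
  by_cases hrn : r ∣ n
  · obtain ⟨n', rfl⟩ := hrn
    have hn' : Squarefree n' := fun x hx => hn x (dvd_mul_of_dvd_right hx r)
    have hrn' : ¬ r ∣ n' := by
      rintro ⟨c, rfl⟩
      have := hn r ⟨c, by ring⟩
      rw [Nat.isUnit_iff] at this
      exact hr.one_lt.ne' this
    have hcop : Nat.Coprime n' (r ^ m) :=
      Nat.Coprime.pow_right _ (Nat.coprime_comm.mp ((Nat.Prime.coprime_iff_not_dvd hr).mpr hrn'))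
    have h4 : n' ∣ 4 := hcop.dvd_of_dvd_mul_right (dvd_trans (Dvd.intro_left _ rfl) h)
    rcases four n' hn' h4 with h' | h' <;> subst h'
    · exact Or.inr (Or.inr (Or.inl (mul_one r)))
    · exact Or.inr (Or.inr (Or.inr (mul_comm r 2)))
  · have hcop : Nat.Coprime n (r ^ m) :=
      Nat.Coprime.pow_right _ (Nat.coprime_comm.mp ((Nat.Prime.coprime_iff_not_dvd hr).mpr hrn))
    rcases four n hn (hcop.dvd_of_dvd_mul_right h) with h' | h'
    · exact Or.inl h'
    · exact Or.inr (Or.inl h')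

/-- Strip a coprime square: `n ∣ m c²` with `n` coprime to `c` gives `n ∣ m`. [folklore] -/
theorem dvd_of_dvd_mul_sq_of_coprime {n m c : ℕ} (h : n ∣ m * c ^ 2) (hc : Nat.Coprime n c) : n ∣ m :=
  (Nat.Coprime.pow_right 2 hc).dvd_of_dvd_mul_right h

/-- If `r d₁` is square-free then `r ∤ d₁`. [folklore] -/
theorem not_dvd_of_squarefree_mul {r : ℕ} (hr : r.Prime) {d₁ : ℤ} (hd : Squarefree ((r : ℤ) * d₁)) : ¬ (r : ℤ) ∣ d₁ := by
  rintro ⟨c, rfl⟩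
  exact (Nat.prime_iff_prime_int.mp hr).not_unit (hd r ⟨c, by ring⟩)

/-- A prime different from the primes `p₁, p₂` does not divide `± 2^i p₁^a p₂^b`-type products: the three cases used below. [folklore] -/
theorem not_dvd_prime_mul {r p₁ p₂ : ℕ} (hr : r.Prime) (hp₁ : p₁.Prime) (hp₂ : p₂.Prime) (h₁ : r ≠ p₁) (h₂ : r ≠ p₂) (h2 : r ≠ 2)
    {c : ℤ} {a b : ℕ} (hc : c = 1 ∨ c = -4 ∨ c = 2) : ¬ (r : ℤ) ∣ c * (p₁ : ℤ) ^ a * (p₂ : ℤ) ^ b := by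
  have hrZ : Prime (r : ℤ) := Nat.prime_iff_prime_int.mp hr
  have hr2' : ¬ (r : ℤ) ∣ 2 := fun h =>
    h2 ((Nat.prime_dvd_prime_iff_eq hr Nat.prime_two).mp (Int.natCast_dvd_natCast.mp h))
  intro h
  rcases hrZ.dvd_or_dvd h with h' | h'
  · rcases hrZ.dvd_or_dvd h' with h'' | h''
    · rcases hc with rfl | rfl | rfl
      · exact hr.one_lt.ne' (Int.natCast_dvd_natCast.mp (by simpa using h'') |> Nat.dvd_one.mp)
      · have : (r : ℤ) ∣ 2 ^ 2 := by rw [show (2 : ℤ) ^ 2 = -(-4) by norm_num]; exact (dvd_neg).mpr h''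
        exact hr2' (hrZ.dvd_of_dvd_pow this)
      · exact hr2' h''
    · exact h₁ ((Nat.prime_dvd_prime_iff_eq hr hp₁).mp (Int.natCast_dvd_natCast.mp (hrZ.dvd_of_dvd_pow h'')))
  · exact h₂ ((Nat.prime_dvd_prime_iff_eq hr hp₂).mp (Int.natCast_dvd_natCast.mp (hrZ.dvd_of_dvd_pow h')))

end Arith

section Selmer

variable {p q l k : ℕ}

/-- `(p/q) = −1` from `(q/p) = +1` (reciprocity at two primes `≡ 3 (mod 4)`). [folklore] -/
theorem jacobiSym_p_q (hp16 : p % 16 = 15) (hq8 : q % 8 = 3) (hJq : jacobiSym (q : ℤ) p = 1) : jacobiSym (p : ℤ) q = -1 := by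
  rw [jacobiSym.quadratic_reciprocity_three_mod_four (by omega) (by omega), hJq]

/-- `(p/l) = −1` from `(l/p) = −1` (reciprocity, `l ≡ 1 (mod 4)`). [folklore] -/
theorem jacobiSym_p_l (hp16 : p % 16 = 15) (hl8 : l % 8 = 5) (hJl : jacobiSym (l : ℤ) p = -1) : jacobiSym (p : ℤ) l = -1 := by
  rw [← jacobiSym.quadratic_reciprocity_one_mod_four (by omega) (Nat.odd_iff.mpr (by omega)), hJl]

/-- `q ≠ p` (as `(q/p) ≠ 0`). [folklore] -/
theorem q_ne_p (hq : q.Prime) (hJq : jacobiSym (q : ℤ) p = 1) : q ≠ p := by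
  rintro rfl
  have : jacobiSym (q : ℤ) q = 0 :=
    jacobiSym.eq_zero_iff.mpr ⟨hq.ne_zero, by rw [Int.gcd_natCast_natCast, Nat.gcd_self]; exact hq.one_lt.ne'⟩
  rw [this] at hJq; exact zero_ne_one hJq

/-- `l ≠ p` (as `(l/p) ≠ 0`). [folklore] -/
theorem l_ne_p (hl : l.Prime) (hJl : jacobiSym (l : ℤ) p = -1) : l ≠ p := by
  rintro rfl
  have : jacobiSym (l : ℤ) l = 0 :=
    jacobiSym.eq_zero_iff.mpr ⟨hl.ne_zero, by rw [Int.gcd_natCast_natCast, Nat.gcd_self]; exact hl.one_lt.ne'⟩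
  rw [this] at hJl; norm_num at hJl

/-- `B = p^k q² l² > 0`. [folklore] -/
theorem b_pos (hp : p.Prime) (hq : q.Prime) (hl : l.Prime) : (0 : ℤ) < (p : ℤ) ^ k * q ^ 2 * l ^ 2 := by
  have := hp.pos; have := hq.pos; have := hl.pos
  positivity

/-- **Reduced-discriminant kill at a prime `r` dividing both coefficients.** For `d` square-free with `r ∣ d` and `d ∣ b = c r²`:
`d = r d₁`, `b/d = r e₁` with `d₁ e₁ = c`; if `−4c` is a non-residue mod `r`, the quartic `w² = d u⁴ + (b/d) z⁴` has no `ℚ_r`-point.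
[cite: SilvermanAEC2009, Prop. X.4.9] -/
theorem not_isSoluble_of_dvd_of_sq_dvd {r : ℕ} [Fact r.Prime] {b c d : ℤ} (hb : b = c * (r : ℤ) ^ 2)
    (hsq : Squarefree d) (hrd : (r : ℤ) ∣ d) (hdb : d ∣ b) (hJ : jacobiSym (-4 * c) r = -1) :
    ¬ ((twoIsogenyQuartic 0 d (b / d)).map (Int.castRingHom ℚ_[r])).IsSoluble := by
  have hr : r.Prime := Fact.out
  have hrZ : Prime (r : ℤ) := Nat.prime_iff_prime_int.mp hr
  obtain ⟨d₁, rfl⟩ := hrd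
  have hrd₁ : ¬ (r : ℤ) ∣ d₁ := not_dvd_of_squarefree_mul hr hsq
  set d' : ℤ := b / (r * d₁) with hd'
  have hdd' : r * d₁ * d' = c * (r : ℤ) ^ 2 := hb ▸ Int.mul_ediv_cancel' hdb
  have hle : (r : ℤ) ∣ d₁ * d' := ⟨c, mul_left_cancel₀ hrZ.ne_zero (by linear_combination hdd')⟩
  obtain ⟨e₁, he₁⟩ : (r : ℤ) ∣ d' := (hrZ.dvd_or_dvd hle).resolve_left hrd₁
  have hde : d₁ * e₁ = c := by
    rw [he₁] at hdd'
    exact mul_left_cancel₀ (pow_ne_zero 2 hrZ.ne_zero) (by linear_combination hdd')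
  refine not_isSoluble_padic_of_dvd_of_not_isSquare_disc (r := r) (a := 0) (a₁ := 0) (d₁ := d₁) (e₁ := e₁) (by ring) rfl he₁ ?_
  rw [show (0 : ℤ) ^ 2 - 4 * d₁ * e₁ = -4 * c by rw [mul_assoc 4, hde]; ring]
  exact ZMod.nonsquare_of_jacobiSym_eq_neg_one hJ

/-! ## §2 `S^{(φ̂)}(X_B) ⊆ {1, p}` -/

/-- Case analysis for a square-free `d` dividing `p^k q² l²` and prime to `l`: `|d| ∈ {1, p, q, pq}`. [folklore] -/
theorem eq_of_squarefree_dvd_phiHat (hp : p.Prime) (hq : q.Prime) (hl : l.Prime) {d : ℤ} (hsq : Squarefree d)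
    (hld : ¬ (l : ℤ) ∣ d) (hdb : d ∣ (p : ℤ) ^ k * q ^ 2 * l ^ 2) :
    d.natAbs = 1 ∨ d.natAbs = p ∨ d.natAbs = q ∨ d.natAbs = p * q := by
  set n := d.natAbs with hn_def
  have hn : Squarefree n := Int.squarefree_natAbs.mpr hsq
  have hnl : ¬ l ∣ n := fun h => hld (Int.natAbs_dvd_natAbs.mp (by simpa [hn_def] using h))
  have h1 : n ∣ p ^ k * q ^ 2 * l ^ 2 := by
    simpa [hn_def, Int.natAbs_mul, Int.natAbs_pow] using Int.natAbs_dvd_natAbs.mpr hdb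
  have h2 : n ∣ p ^ k * q ^ 2 :=
    dvd_of_dvd_mul_sq_of_coprime h1 (Nat.coprime_comm.mp ((Nat.Prime.coprime_iff_not_dvd hl).mpr hnl))
  by_cases hqn : q ∣ n
  · obtain ⟨n', hn'⟩ := hqn
    have hn'sq : Squarefree n' := fun x hx => hn x (hn' ▸ dvd_mul_of_dvd_right hx q)
    have hqn' : ¬ q ∣ n' := by
      rintro ⟨c, rfl⟩
      have := hn q ⟨c, by rw [hn']; ring⟩
      rw [Nat.isUnit_iff] at this
      exact hq.one_lt.ne' this
    have h3 : n' ∣ p ^ k * q := by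
      have : q * n' ∣ q * (p ^ k * q) := by rw [show q * (p ^ k * q) = p ^ k * q ^ 2 by ring, ← hn']; exact h2
      exact (Nat.mul_dvd_mul_iff_left hq.pos).mp this
    have h4 : n' ∣ p ^ k :=
      (Nat.coprime_comm.mp ((Nat.Prime.coprime_iff_not_dvd hq).mpr hqn')).dvd_of_dvd_mul_right h3
    rcases eq_one_or_eq_of_squarefree_dvd_prime_pow hp hn'sq h4 with h | h
    · right; right; left; rw [hn', h, mul_one]
    · right; right; right; rw [hn', h, mul_comm]
  · have h4 : n ∣ p ^ k :=
      dvd_of_dvd_mul_sq_of_coprime h2 (Nat.coprime_comm.mp ((Nat.Prime.coprime_iff_not_dvd hq).mpr hqn))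
    rcases eq_one_or_eq_of_squarefree_dvd_prime_pow hp hn h4 with h | h
    · exact Or.inl h
    · exact Or.inr (Or.inl h)

/-- ★ **`S^{(φ̂)}(X_B) ⊆ {1, p}`** — the descent-on-divisors-of-`B` Selmer set of `X_B : y² = x³ + B x`, `B = p^k q² l²`, in the cell:
negatives die over `ℝ`; `l ∣ d` dies `l`-adically; `q` and `pq` die `2`-adically; `1 = δ(O)` and `p ≡ B = δ(T)` remain.
[cite: SilvermanAEC2009, Prop. X.4.9 and Remark X.4.9.1] -/
theorem mem_twoIsogenySelmerGroup_phiHat (hp : p.Prime) (hq : q.Prime) (hl : l.Prime) (hp16 : p % 16 = 15) (hq8 : q % 8 = 3)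
    (hl8 : l % 8 = 5) (hJl : jacobiSym (l : ℤ) p = -1) (hk : k = 1 ∨ k = 3) {d : ℤ}
    (h : d ∈ twoIsogenySelmerGroup 0 ((p : ℤ) ^ k * q ^ 2 * l ^ 2)) : d = 1 ∨ d = p := by
  haveI : Fact (Nat.Prime 2) := ⟨Nat.prime_two⟩
  haveI : Fact l.Prime := ⟨hl⟩
  have hlp : l ≠ p := l_ne_p hl hJl
  have hql : q ≠ l := by omega
  have hb0 := b_pos (k := k) hp hq hl
  obtain ⟨hsq, hdvd, hloc⟩ := (mem_twoIsogenySelmerGroup_iff hb0.ne').mp h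
  -- `d > 0`
  have hd0 : 0 < d := by
    by_contra hle
    have hd0 : d < 0 := lt_of_le_of_ne (not_lt.mp hle) hsq.ne_zero
    have hmul : d * ((p : ℤ) ^ k * q ^ 2 * l ^ 2 / d) = (p : ℤ) ^ k * q ^ 2 * l ^ 2 := Int.mul_ediv_cancel' hdvd
    have hd'0 : (p : ℤ) ^ k * q ^ 2 * l ^ 2 / d < 0 := by
      by_contra hge
      push Not at hge
      nlinarith [mul_nonneg (neg_pos.mpr hd0).le hge]
    exact not_isSoluble_real_twoIsogenyQuartic_of_neg hd0 hd'0 le_rfl hloc.1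
  -- `l ∤ d`
  have hld : ¬ (l : ℤ) ∣ d := by
    intro hld
    refine not_isSoluble_of_dvd_of_sq_dvd (r := l) (c := (p : ℤ) ^ k * q ^ 2) (by ring) hsq hld hdvd ?_ (hloc.2 l)
    have hkodd : Odd k := by rcases hk with rfl | rfl <;> decide
    have hg : ((2 * q : ℕ) : ℤ).gcd l = 1 := by
      rw [Int.gcd_natCast_natCast]
      exact Nat.Coprime.mul_left ((Nat.coprime_primes Nat.prime_two hl).mpr (by omega)) ((Nat.coprime_primes hq hl).mpr hql)
    rw [show (-4 * ((p : ℤ) ^ k * q ^ 2) : ℤ) = -1 * (p : ℤ) ^ k * ((2 * q : ℕ) : ℤ) ^ 2 by push_cast; ring,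
      jacobiSym.mul_left, jacobiSym.mul_left, jacobiSym.at_neg_one (Nat.odd_iff.mpr (by omega)),
      ZMod.χ₄_nat_one_mod_four (by omega), jacobiSym.pow_left, jacobiSym_p_l hp16 hl8 hJl, jacobiSym.sq_one' hg,
      hkodd.neg_one_pow]
    norm_num
  rcases eq_of_squarefree_dvd_phiHat hp hq hl (k := k) hsq hld hdvd with h1 | h2 | h3 | h4
  · left; omega
  · right; omega
  · -- the class `q`: `2`-adically
    exfalso
    obtain rfl : d = q := by omega
    have hq0 : (q : ℤ) ≠ 0 := by exact_mod_cast hq.ne_zero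
    have hdiv : (p : ℤ) ^ k * q ^ 2 * l ^ 2 / q = (p : ℤ) ^ k * q * l ^ 2 := Int.ediv_eq_of_eq_mul_right hq0 (by ring)
    have h2 := hloc.2 2
    rw [hdiv] at h2
    exact not_isSoluble_two_q hp16 hq8 hl8 hk h2
  · -- the class `pq`: `2`-adically
    exfalso
    obtain rfl : d = p * q := by
      have : ((p * q : ℕ) : ℤ) = (p : ℤ) * q := by push_cast; ring
      omega
    have hpq0 : (p : ℤ) * q ≠ 0 := by exact_mod_cast (Nat.mul_ne_zero hp.ne_zero hq.ne_zero)
    have hpk : (p : ℤ) ^ k = p * p ^ (k - 1) := by rw [← pow_succ']; congr 1; omega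
    have hdiv : (p : ℤ) ^ k * q ^ 2 * l ^ 2 / (p * q) = (p : ℤ) ^ (k - 1) * q * l ^ 2 :=
      Int.ediv_eq_of_eq_mul_right hpq0 (by rw [hpk]; ring)
    have h2 := hloc.2 2
    rw [hdiv] at h2
    exact not_isSoluble_two_pq hp16 hq8 hl8 hk h2

/-- Case analysis for a square-free `d` dividing `−4 p^k q² l²` and prime to `q l`: `|d| ∈ {1, 2, p, 2p}`. [folklore] -/
theorem eq_of_squarefree_dvd_phi (hp : p.Prime) (hq : q.Prime) (hl : l.Prime) {d : ℤ} (hsq : Squarefree d) (hld : ¬ (l : ℤ) ∣ d)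
    (hqd : ¬ (q : ℤ) ∣ d) (hdb : d ∣ -4 * ((p : ℤ) ^ k * q ^ 2 * l ^ 2)) :
    d.natAbs = 1 ∨ d.natAbs = 2 ∨ d.natAbs = p ∨ d.natAbs = 2 * p := by
  set n := d.natAbs with hn
  have hsqn : Squarefree n := Int.squarefree_natAbs.mpr hsq
  have hnl : ¬ l ∣ n := fun h => hld (Int.natAbs_dvd_natAbs.mp (by simpa [hn] using h))
  have hnq : ¬ q ∣ n := fun h => hqd (Int.natAbs_dvd_natAbs.mp (by simpa [hn] using h))
  have h1' : n ∣ 4 * (p ^ k * q ^ 2 * l ^ 2) := by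
    simpa [hn, Int.natAbs_mul, Int.natAbs_pow, Int.natAbs_neg] using Int.natAbs_dvd_natAbs.mpr hdb
  have h1 : n ∣ 4 * p ^ k * q ^ 2 * l ^ 2 := by simpa [mul_assoc] using h1'
  have h2 : n ∣ 4 * p ^ k * q ^ 2 :=
    dvd_of_dvd_mul_sq_of_coprime h1 (Nat.coprime_comm.mp ((Nat.Prime.coprime_iff_not_dvd hl).mpr hnl))
  have h3 : n ∣ 4 * p ^ k :=
    dvd_of_dvd_mul_sq_of_coprime h2 (Nat.coprime_comm.mp ((Nat.Prime.coprime_iff_not_dvd hq).mpr hnq))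
  exact eq_of_squarefree_dvd_four_mul_prime_pow hp hsqn h3

end Selmer

end Summit.BirchSwinnertonDyer.BirchSwinnertonDyer.Theorems.BiquadraticEisensteinDescentHeegnerTwistCouplingInSupplyQuarticCellPhiHat

end
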